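import Literature.MathematicalPhysics.QuantumFieldTheory.Dimock2011to13.UrsellTreeGraphBound

/-!
# NE5 ∕ U3 — convergence of the ORDERED series (2.13), part 1: the TREE-GRAPH SUMMATION (sum over tuples of polymers
# fitting a rooted forest, by root deletion)

Cell `pub-balaban`, unit `b2b-balaban-t4-ne5-formalise-leaf-08` (NE5 formalisation swarm, LEAF PROVER 08; row O1-d2 follower (iii),
journal INTENT l.6289).  Summits-side NEW WORK under the LEAN PLACEMENT RULE (generic finite combinatorics; cell bookkeeping for the
term family `B13StepTermFamily.term` of p207797).  HONEST FRAMING: rung (B)+1 of the FINITE-VOLUME T⁴ continuum programme — NOT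
infinite volume, NOT a mass gap, NOT the Clay problem, NOT a proof of NE5.  HONEST DEPENDENCY (cell line, verbatim): continuum YM on
T⁴ ⇐ BetaPertH ∧ nine spine estimates (0/9 proved); BetaPertH ⇐ (D1) ∧ (D4) ∧ CAP+tail; G-an2-4 gates asym, D1 and NE2/3/4.

WHY.  [Balaban1988RG2Cluster] p. 20 cites the convergence of the expansions (2.12)∕(2.13) to *"[26, 67, 25, 50]"*; route P1's
termwise interface (`T4InputCauchyRateTermwise.TermRep`) needs it in the ORDERED-TUPLE form — absolute summability of the Ursell
terms `(1/N!)ρᵀ(Z₁,…,Z_N)H(Z₁)⋯H(Z_N)` — whose printed mechanism (Dimock, Rev. Math. Phys. 25 (2013) App. B step 4,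
(spit2)–(sunshine); Brydges 1986) is: `|ρᵀ(Z⃗)| ≤ #{tree graphs inside the overlap graph of Z⃗}` (TREE:
`UrsellTreeGraphBound.abs_hcUrsell_le_card_treeGraphs`) and `Σ_τ Π_u (d_u − 1)! ≤ (N−2)!·4^{N−1}` (TREE:
`CayleyDegreeFormula.sum_trees_prod_factorial_le`), glued by the SUM OVER TUPLES FITTING A TREE — the object of this file.

WHAT IS PROVED (generic: a finite index type `ι`, a finite polymer type `P` with footprints `cubes : P → Finset Q`, a hard core
`inc` that is FOOTPRINT-LOCAL through `reach` (`inc Z′ Z → ∃ q ∈ reach Z, q ∈ cubes Z′`, `#reach Z ≤ ν·#cubes Z` — verbatim the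
hypotheses of the tree's `B13Resummation.kp_condition`), a nonnegative activity majorant `w` with the ANCHORED EXPONENTIAL NORM
`Σ_{Z ∋ q} w(Z)·e^{#cubes Z} ≤ Φ` for every cube `q` — the (2.38)+(1.26)-KIND input, a displayed binder):
* §1 `ind`, the pinned tuple domains `pinned p₀ S` (tuples `ι → P` frozen at `p₀` off `S`) and the one-coordinate splitting
  `sum_pinned_erase`;
* §2 `W p₀ cubes inc w S R τ a` = Σ over pinned tuples of 𝟙[anchors: a r ∈ Z_r, r ∈ R]·𝟙[edges: Z_u ∼ Z_{τ u}, u ∈ S∖R]·Π_{u∈S} w(Z_u);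
* §3 **`W_le`**: for a rooted forest `τ` on `S` with roots `R` (`CayleyForests.IsForestOn`),
  `W ≤ Φ^{#S} · ν^{#S − #R} · Π_{u∈S} (#children_u)!`, uniformly in the anchors — by ROOT DELETION (`CayleyForests.cut`,
  `children_glue_of_ne` BY NAME): summing out a root costs `Φ`, each of its `c` children an anchor in the `reach` of the root's
  polymer (`ν·#cubes`), and `#cubes^c ≤ c!·e^{#cubes}` is absorbed by the exponential norm.
Part 2 (`UrsellSeriesBound`) combines `W_le` with the two TREE inequalities into the level bounds of the ordered series.
Nothing of the manuscripts under audit is asserted ([II] cited for the locus of its citation only).  0 sorry; axioms ⊆ {propext,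
Classical.choice, Quot.sound}.
-/

noncomputable section

open Finset
open scoped BigOperators

namespace Summit.QuantumFields.BalabanUV.T4Continuum.UrsellTreeSum

open Literature.Combinatorics.Enumerative (IsForestOn children mem_children cut glue_cut children_subset isForestOn_cut)
open Literature.Combinatorics.Enumerative.CayleyDegreeFormula (children_glue_of_ne)

variable {ι P Q : Type*} [Fintype ι] [DecidableEq ι] [Fintype P] [DecidableEq Q]

/-! ## §1 Indicators, pinned tuple domains, one-coordinate splitting -/

/-- [folklore] The real indicator of a decidable proposition. -/
def ind (p : Prop) [Decidable p] : ℝ := if p then 1 else 0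

omit [Fintype ι] [DecidableEq ι] [Fintype P] [DecidableEq Q] in
/-- [folklore] Indicators are nonnegative. -/
theorem ind_nonneg (p : Prop) [Decidable p] : 0 ≤ ind p := by
  unfold ind; split_ifs <;> norm_num

omit [Fintype ι] [DecidableEq ι] [Fintype P] [DecidableEq Q] in
/-- [folklore] Indicators are at most one. -/
theorem ind_le_one (p : Prop) [Decidable p] : ind p ≤ 1 := by
  unfold ind; split_ifs <;> norm_num

omit [Fintype ι] [DecidableEq ι] [Fintype P] [DecidableEq Q] in
/-- [folklore] The indicator of a true proposition. -/
theorem ind_of_pos {p : Prop} [Decidable p] (h : p) : ind p = 1 := if_pos h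

omit [Fintype ι] [DecidableEq ι] [Fintype P] [DecidableEq Q] in
/-- [folklore] The indicator of a false proposition. -/
theorem ind_of_neg {p : Prop} [Decidable p] (h : ¬ p) : ind p = 0 := if_neg h

/-- [folklore] The PINNED TUPLE DOMAIN: tuples `ι → P` frozen at `p₀` off the active index set `S`. -/
def pinned (p₀ : P) (S : Finset ι) : Finset (ι → P) := Fintype.piFinset fun i => if i ∈ S then univ else {p₀}

/-- [folklore] Membership in the pinned domain: frozen off `S`. -/
theorem mem_pinned {p₀ : P} {S : Finset ι} {Z : ι → P} : Z ∈ pinned p₀ S ↔ ∀ i, i ∉ S → Z i = p₀ := by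
  simp only [pinned, Fintype.mem_piFinset]
  refine ⟨fun h i hi => ?_, fun h i => ?_⟩
  · have := h i; rw [if_neg hi, mem_singleton] at this; exact this
  · by_cases hi : i ∈ S
    · rw [if_pos hi]; exact mem_univ _
    · rw [if_neg hi, mem_singleton]; exact h i hi

/-- [folklore] The pinned domain of the empty active set is the frozen tuple. -/
theorem pinned_empty (p₀ : P) : pinned p₀ (∅ : Finset ι) = {fun _ => p₀} := by
  ext Z; simp only [mem_pinned, notMem_empty, not_false_eq_true, forall_const, mem_singleton, funext_iff]

/-- [folklore] The pinned domain of the full index set is every tuple. -/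
theorem pinned_univ (p₀ : P) : pinned p₀ (univ : Finset ι) = univ := by ext Z; simp [mem_pinned]

/-- [folklore] **ONE-COORDINATE SPLITTING**: summing over the pinned tuples of `S ∋ r` = summing the `r`-th coordinate over `P`
and the rest over the pinned tuples of `S ∖ {r}` (the bijection `(p, Z′) ↦ update Z′ r p`). -/
theorem sum_pinned_erase (p₀ : P) {S : Finset ι} {r : ι} (hr : r ∈ S) (F : (ι → P) → ℝ) :
    ∑ Z ∈ pinned p₀ S, F Z = ∑ p : P, ∑ Z ∈ pinned p₀ (S.erase r), F (Function.update Z r p) := by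
  rw [← Finset.sum_product' (s := (univ : Finset P)) (t := pinned p₀ (S.erase r))
    (f := fun p Z => F (Function.update Z r p))]
  refine Finset.sum_nbij' (fun Z => (Z r, Function.update Z r p₀)) (fun x => Function.update x.2 r x.1) ?_ ?_ ?_ ?_ ?_
  · intro Z hZ
    rw [mem_pinned] at hZ
    simp only [mem_product, mem_univ, true_and, mem_pinned]
    intro i hi
    by_cases hir : i = r
    · subst hir; exact Function.update_self _ _ _
    · rw [Function.update_of_ne hir]
      exact hZ i fun h => hi (mem_erase.2 ⟨hir, h⟩)
  · rintro ⟨p, Z⟩ hx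
    simp only [mem_product, mem_univ, true_and, mem_pinned] at hx
    rw [mem_pinned]
    intro i hi
    have hir : i ≠ r := fun h => hi (h ▸ hr)
    rw [Function.update_of_ne hir]
    exact hx i fun h => hi (mem_of_mem_erase h)
  · intro Z _
    simp only [Function.update_idem, Function.update_eq_self]
  · rintro ⟨p, Z⟩ hx
    simp only [mem_product, mem_univ, true_and, mem_pinned] at hx
    simp only [Function.update_self, Function.update_idem, Prod.mk.injEq, true_and]
    exact Function.update_eq_self_iff.2 (hx r (notMem_erase r S)).symm
  · intro Z _
    simp only [Function.update_idem, Function.update_eq_self]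

/-! ## §2 The forest-indexed weighted tuple sum -/

/-- [folklore] **THE WEIGHTED TUPLE SUM OF A ROOTED FOREST**: over the tuples pinned off `S`, the product of the ANCHOR indicators
(`a r ∈ cubes (Z r)` for the roots `r ∈ R`), the EDGE indicators (`Z u` incompatible with `Z (τ u)` for the non-roots `u`) and the
activity majorants `w (Z u)`, `u ∈ S`. -/
def W (p₀ : P) (cubes : P → Finset Q) (inc : P → P → Prop) [DecidableRel inc] (w : P → ℝ) (S R : Finset ι) (τ : ι → ι)
    (a : ι → Q) : ℝ :=
  ∑ Z ∈ pinned p₀ S, (∏ r ∈ R, ind (a r ∈ cubes (Z r))) * (∏ u ∈ S \ R, ind (inc (Z u) (Z (τ u)))) * ∏ u ∈ S, w (Z u)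

section Bound

variable (p₀ : P) (cubes reach : P → Finset Q) (inc : P → P → Prop) [DecidableRel inc] (w : P → ℝ) {ν Φ : ℝ}

omit [Fintype ι] [Fintype P] in
/-- [folklore] The summand of `W` is nonnegative for a nonnegative majorant. -/
theorem summand_nonneg (hw : ∀ Z, 0 ≤ w Z) (S R : Finset ι) (τ : ι → ι) (a : ι → Q) (Z : ι → P) :
    0 ≤ (∏ r ∈ R, ind (a r ∈ cubes (Z r))) * (∏ u ∈ S \ R, ind (inc (Z u) (Z (τ u)))) * ∏ u ∈ S, w (Z u) :=
  mul_nonneg (mul_nonneg (prod_nonneg fun _ _ => ind_nonneg _) (prod_nonneg fun _ _ => ind_nonneg _))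
    (prod_nonneg fun _ _ => hw _)

/-- [folklore] `W` is nonnegative for a nonnegative majorant. -/
theorem W_nonneg (hw : ∀ Z, 0 ≤ w Z) (S R : Finset ι) (τ : ι → ι) (a : ι → Q) : 0 ≤ W p₀ cubes inc w S R τ a :=
  sum_nonneg fun Z _ => summand_nonneg cubes inc w hw S R τ a Z

omit [Fintype ι] [DecidableEq ι] in
/-- [folklore] **THE ROOT'S MOMENT BOUND**: `Σ_{p ∋ q} w(p)·(#cubes p)^c ≤ c!·Φ` from the exponential norm (`x^c ≤ c!·eˣ`). -/
theorem sum_anchor_pow_le (hw : ∀ Z, 0 ≤ w Z)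
    (hΦ : ∀ q : Q, ∑ p : P, ind (q ∈ cubes p) * w p * Real.exp ((cubes p).card) ≤ Φ) (q : Q) (c : ℕ) :
    ∑ p : P, ind (q ∈ cubes p) * w p * ((cubes p).card : ℝ) ^ c ≤ (c.factorial : ℝ) * Φ := by
  calc ∑ p : P, ind (q ∈ cubes p) * w p * ((cubes p).card : ℝ) ^ c
      ≤ ∑ p : P, (c.factorial : ℝ) * (ind (q ∈ cubes p) * w p * Real.exp ((cubes p).card)) := by
        refine sum_le_sum fun p _ => ?_
        have hfac : (0 : ℝ) < c.factorial := by exact_mod_cast c.factorial_pos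
        have h := Real.pow_div_factorial_le_exp (x := ((cubes p).card : ℝ)) (Nat.cast_nonneg _) c
        rw [div_le_iff₀ hfac] at h
        have h0 : 0 ≤ ind (q ∈ cubes p) * w p := mul_nonneg (ind_nonneg _) (hw p)
        calc ind (q ∈ cubes p) * w p * ((cubes p).card : ℝ) ^ c
            ≤ ind (q ∈ cubes p) * w p * (Real.exp ((cubes p).card) * c.factorial) := mul_le_mul_of_nonneg_left h h0
          _ = (c.factorial : ℝ) * (ind (q ∈ cubes p) * w p * Real.exp ((cubes p).card)) := by ring
    _ = (c.factorial : ℝ) * ∑ p : P, ind (q ∈ cubes p) * w p * Real.exp ((cubes p).card) := by rw [mul_sum]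
    _ ≤ (c.factorial : ℝ) * Φ := mul_le_mul_of_nonneg_left (hΦ q) (Nat.cast_nonneg _)

omit [Fintype P] in
/-- [folklore] **THE CHILDREN'S ANCHORS**: if every incompatibility `Z′ ∼ p` is witnessed by a cube of `Z′` in `reach p`, then the
product of the edge indicators of the children `C` of a root carrying the polymer `p` is dominated by the sum, over the choice
functions `g` picking an anchor in `reach p` for every child (and frozen to `a` elsewhere), of the product of the anchor indicators. -/
theorem prod_ind_children_le (hloc : ∀ Z Z', inc Z' Z → ∃ q ∈ reach Z, q ∈ cubes Z') (C : Finset ι) (a : ι → Q) (p : P)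
    (Z' : ι → P) : ∏ u ∈ C, ind (inc (Z' u) p) ≤
      ∑ g ∈ Fintype.piFinset (fun u => if u ∈ C then reach p else {a u}), ∏ u ∈ C, ind (g u ∈ cubes (Z' u)) := by
  have hnn : ∀ g ∈ Fintype.piFinset (fun u => if u ∈ C then reach p else {a u}), 0 ≤ ∏ u ∈ C, ind (g u ∈ cubes (Z' u)) :=
    fun g _ => prod_nonneg fun _ _ => ind_nonneg _
  by_cases h : ∀ u ∈ C, inc (Z' u) p
  · choose f hf using fun u (hu : u ∈ C) => hloc p (Z' u) (h u hu)
    let g : ι → Q := fun u => if hu : u ∈ C then f u hu else a u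
    have hg : g ∈ Fintype.piFinset (fun u => if u ∈ C then reach p else {a u}) := by
      rw [Fintype.mem_piFinset]
      intro u
      by_cases hu : u ∈ C
      · simp only [g, dif_pos hu, if_pos hu]; exact (hf u hu).1
      · simp only [g, dif_neg hu, if_neg hu]; exact mem_singleton_self _
    calc ∏ u ∈ C, ind (inc (Z' u) p) ≤ 1 := prod_le_one (fun _ _ => ind_nonneg _) fun _ _ => ind_le_one _
      _ = ∏ u ∈ C, ind (g u ∈ cubes (Z' u)) := by
          refine (prod_eq_one fun u hu => ?_).symm
          simp only [g, dif_pos hu]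
          exact ind_of_pos (hf u hu).2
      _ ≤ _ := single_le_sum hnn hg
  · push Not at h
    obtain ⟨u, hu, hnot⟩ := h
    rw [prod_eq_zero hu (ind_of_neg hnot)]
    exact sum_nonneg hnn

omit [Fintype P] [DecidableEq Q] in
/-- [folklore] The number of anchor choice functions for the children: `(#reach p)^{#C}`. -/
theorem card_choices (C : Finset ι) (a : ι → Q) (p : P) :
    (Fintype.piFinset (fun u => if u ∈ C then reach p else {a u})).card = (reach p).card ^ C.card := by
  rw [Fintype.card_piFinset]
  have : ∀ u, (if u ∈ C then reach p else {a u}).card = if u ∈ C then (reach p).card else 1 := by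
    intro u; split_ifs <;> simp
  simp_rw [this]
  rw [prod_ite, prod_const_one, mul_one, prod_const]
  congr 1
  simp

/-! ## §3 The bound by root deletion -/

omit [Fintype ι] [Fintype P] [DecidableEq Q] in
/-- [folklore] Root deletion does not change the children of the other vertices (`children_glue_of_ne` + `glue_cut`). -/
theorem children_cut_eq {S R : Finset ι} {r : ι} (hr : r ∈ R) (τ : ι → ι) {u : ι} (hu : u ≠ r) :
    children (S.erase r) (R.erase r ∪ children S R r τ) u (cut S R r τ) = children S R u τ := by
  conv_rhs => rw [← glue_cut (S := S) (R := R) (ρ := r) τ]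
  exact (children_glue_of_ne hr _ _ hu).symm

omit [Fintype ι] [Fintype P] [DecidableEq Q] in
/-- [folklore] After deleting the root `r ∈ R`, the non-root vertices are the old non-roots minus the children of `r`. -/
theorem erase_sdiff_eq {S R : Finset ι} {r : ι} (hr : r ∈ R) (τ : ι → ι) :
    S.erase r \ (R.erase r ∪ children S R r τ) = (S \ R) \ children S R r τ := by
  ext u
  simp only [mem_sdiff, mem_erase, mem_union, mem_children, not_or, not_and]
  constructor
  · rintro ⟨⟨hur, huS⟩, hR, hC⟩
    exact ⟨⟨huS, fun huR => hR hur huR⟩, fun h1 h2 => hC h1 h2⟩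
  · rintro ⟨⟨huS, huR⟩, hC⟩
    exact ⟨⟨fun h => huR (h ▸ hr), huS⟩, fun _ => huR, hC⟩

/-- [folklore] **THE TREE-GRAPH SUMMATION.**  For a rooted forest `τ` on `S` with roots `R ⊆ S`, footprint-local hard core,
nonnegative majorant with anchored exponential norm `Φ`, reach factor `ν ≥ 0`:
`W(S, R, τ, a) ≤ Φ^{#S} · ν^{#S − #R} · Π_{u ∈ S} (#children_u)!`, uniformly in the anchors `a` (Dimock's step 4 organises the same
count by tree graphs `τ` with `τ(j) < j`; here the forest is peeled from its roots). -/
theorem W_le (hloc : ∀ Z Z', inc Z' Z → ∃ q ∈ reach Z, q ∈ cubes Z') (hν : 0 ≤ ν)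
    (hreach : ∀ Z, ((reach Z).card : ℝ) ≤ ν * (cubes Z).card) (hw : ∀ Z, 0 ≤ w Z)
    (hΦ : ∀ q : Q, ∑ p : P, ind (q ∈ cubes p) * w p * Real.exp ((cubes p).card) ≤ Φ) :
    ∀ (S R : Finset ι) (τ : ι → ι) (a : ι → Q), R ⊆ S → IsForestOn S R τ →
      W p₀ cubes inc w S R τ a ≤ Φ ^ S.card * ν ^ (S.card - R.card) * ∏ u ∈ S, ((children S R u τ).card.factorial : ℝ) := by
  intro S
  induction S using Finset.strongInduction with
  | H S ih =>
  intro R τ a hRS hτ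
  rcases R.eq_empty_or_nonempty with hR | ⟨r, hr⟩
  · -- no roots: the vertex set is empty, `W = 1`
    subst hR
    have hS : S = ∅ := by
      rcases S.eq_empty_or_nonempty with h | ⟨v, hv⟩
      · exact h
      · obtain ⟨n, hn⟩ := hτ.2 v hv
        exact absurd hn (notMem_empty _)
    subst hS
    simp [W, pinned_empty]
  -- delete the root `r`
  have hrS : r ∈ S := hRS hr
  set C := children S R r τ with hCdef
  have hCsub : C ⊆ S \ R := children_subset τ
  set τ' := cut S R r τ with hτ'def
  set R' := R.erase r ∪ C with hR'def
  have hR'S' : R' ⊆ S.erase r := by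
    intro u hu
    rcases mem_union.1 hu with hu | hu
    · exact mem_erase.2 ⟨(mem_erase.1 hu).1, hRS (mem_erase.1 hu).2⟩
    · have := mem_sdiff.1 (hCsub hu)
      exact mem_erase.2 ⟨fun h => this.2 (h ▸ hr), this.1⟩
  have hτ' : IsForestOn (S.erase r) R' τ' := isForestOn_cut hr hRS hτ
  have hlt : S.erase r ⊂ S := erase_ssubset hrS
  -- the bound for the deleted forest, uniform in the anchors
  set M : ℝ := Φ ^ (S.erase r).card * ν ^ ((S.erase r).card - R'.card) *
    ∏ u ∈ S.erase r, ((children (S.erase r) R' u τ').card.factorial : ℝ) with hMdef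
  have hM : ∀ g : ι → Q, W p₀ cubes inc w (S.erase r) R' τ' g ≤ M := fun g => ih _ hlt R' τ' g hR'S' hτ'
  have hM0 : 0 ≤ M := le_trans (W_nonneg p₀ cubes inc w hw _ _ _ a) (hM a)
  -- the integrand at an updated tuple
  have hsplit : ∀ (p : P) (Z' : ι → P),
      (∏ r' ∈ R, ind (a r' ∈ cubes (Function.update Z' r p r'))) *
        (∏ u ∈ S \ R, ind (inc (Function.update Z' r p u) (Function.update Z' r p (τ u)))) *
        ∏ u ∈ S, w (Function.update Z' r p u) =
      ind (a r ∈ cubes p) * w p * (∏ u ∈ C, ind (inc (Z' u) p)) *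
        ((∏ r' ∈ R.erase r, ind (a r' ∈ cubes (Z' r'))) *
          (∏ u ∈ (S \ R) \ C, ind (inc (Z' u) (Z' (τ u)))) * ∏ u ∈ S.erase r, w (Z' u)) := by
    intro p Z'
    rw [← mul_prod_erase R _ hr, ← mul_prod_erase S _ hrS, ← prod_sdiff hCsub]
    have h1 : ∏ r' ∈ R.erase r, ind (a r' ∈ cubes (Function.update Z' r p r')) =
        ∏ r' ∈ R.erase r, ind (a r' ∈ cubes (Z' r')) :=
      prod_congr rfl fun r' hr' => by rw [Function.update_of_ne (mem_erase.1 hr').1]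
    have h2 : ∏ u ∈ S.erase r, w (Function.update Z' r p u) = ∏ u ∈ S.erase r, w (Z' u) :=
      prod_congr rfl fun u hu => by rw [Function.update_of_ne (mem_erase.1 hu).1]
    have h3 : ∏ u ∈ C, ind (inc (Function.update Z' r p u) (Function.update Z' r p (τ u))) =
        ∏ u ∈ C, ind (inc (Z' u) p) :=
      prod_congr rfl fun u hu => by
        have hu' := mem_children.1 hu
        have hur : u ≠ r := fun h => hu'.1.2 (h ▸ hr)
        rw [Function.update_of_ne hur, hu'.2, Function.update_self]
    have h4 : ∏ u ∈ (S \ R) \ C, ind (inc (Function.update Z' r p u) (Function.update Z' r p (τ u))) =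
        ∏ u ∈ (S \ R) \ C, ind (inc (Z' u) (Z' (τ u))) :=
      prod_congr rfl fun u hu => by
        obtain ⟨huSR, huC⟩ := mem_sdiff.1 hu
        have hur : u ≠ r := fun h => (mem_sdiff.1 huSR).2 (h ▸ hr)
        have hτur : τ u ≠ r := fun h => huC (mem_children.2 ⟨⟨(mem_sdiff.1 huSR).1, (mem_sdiff.1 huSR).2⟩, h⟩)
        rw [Function.update_of_ne hur, Function.update_of_ne hτur]
    rw [h1, h2, h3, h4]
    try simp only [Function.update_self]
    ring
  -- the inner sum over the remaining tuples, for a fixed root polymer `p`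
  have hinner : ∀ p : P,
      ∑ Z' ∈ pinned p₀ (S.erase r), (∏ u ∈ C, ind (inc (Z' u) p)) *
          ((∏ r' ∈ R.erase r, ind (a r' ∈ cubes (Z' r'))) *
            (∏ u ∈ (S \ R) \ C, ind (inc (Z' u) (Z' (τ u)))) * ∏ u ∈ S.erase r, w (Z' u)) ≤
        ((reach p).card : ℝ) ^ C.card * M := by
    intro p
    set T : Finset (ι → Q) := Fintype.piFinset (fun u => if u ∈ C then reach p else {a u}) with hTdef
    have hG0 : ∀ Z' : ι → P, 0 ≤ (∏ r' ∈ R.erase r, ind (a r' ∈ cubes (Z' r'))) *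
        (∏ u ∈ (S \ R) \ C, ind (inc (Z' u) (Z' (τ u)))) * ∏ u ∈ S.erase r, w (Z' u) := fun Z' =>
      mul_nonneg (mul_nonneg (prod_nonneg fun _ _ => ind_nonneg _) (prod_nonneg fun _ _ => ind_nonneg _))
        (prod_nonneg fun _ _ => hw _)
    -- replace the children's edge indicators by the sum over anchor choices, then swap the sums
    have hstep : ∀ Z' : ι → P, (∏ u ∈ C, ind (inc (Z' u) p)) *
        ((∏ r' ∈ R.erase r, ind (a r' ∈ cubes (Z' r'))) *
          (∏ u ∈ (S \ R) \ C, ind (inc (Z' u) (Z' (τ u)))) * ∏ u ∈ S.erase r, w (Z' u)) ≤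
        ∑ g ∈ T, (∏ r'' ∈ R', ind (g r'' ∈ cubes (Z' r''))) *
          (∏ u ∈ S.erase r \ R', ind (inc (Z' u) (Z' (τ' u)))) * ∏ u ∈ S.erase r, w (Z' u) := by
      intro Z'
      refine (mul_le_mul_of_nonneg_right (prod_ind_children_le cubes reach inc hloc C a p Z') (hG0 Z')).trans ?_
      rw [sum_mul]
      refine sum_le_sum fun g hg => le_of_eq ?_
      rw [Fintype.mem_piFinset] at hg
      have hga : ∀ r' ∈ R.erase r, g r' = a r' := fun r' hr' => by
        have hr'C : r' ∉ C := fun h => (mem_sdiff.1 (hCsub h)).2 (mem_erase.1 hr').2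
        have := hg r'; rw [if_neg hr'C, mem_singleton] at this; exact this
      have hdisj : Disjoint (R.erase r) C :=
        disjoint_left.2 fun u hu huC => (mem_sdiff.1 (hCsub huC)).2 (mem_erase.1 hu).2
      rw [hR'def, prod_union hdisj, erase_sdiff_eq hr τ]
      have h5 : ∏ r'' ∈ R.erase r, ind (g r'' ∈ cubes (Z' r'')) = ∏ r' ∈ R.erase r, ind (a r' ∈ cubes (Z' r')) :=
        prod_congr rfl fun r' hr' => by rw [hga r' hr']
      have h6 : ∏ u ∈ (S \ R) \ C, ind (inc (Z' u) (Z' (τ' u))) = ∏ u ∈ (S \ R) \ C, ind (inc (Z' u) (Z' (τ u))) :=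
        prod_congr rfl fun u hu => by
          have huC : u ∉ C := (mem_sdiff.1 hu).2
          have : τ' u = τ u := by rw [hτ'def]; unfold cut; rw [if_neg]; exact huC
          rw [this]
      rw [h5, h6]
      ring
    calc ∑ Z' ∈ pinned p₀ (S.erase r), (∏ u ∈ C, ind (inc (Z' u) p)) *
            ((∏ r' ∈ R.erase r, ind (a r' ∈ cubes (Z' r'))) *
              (∏ u ∈ (S \ R) \ C, ind (inc (Z' u) (Z' (τ u)))) * ∏ u ∈ S.erase r, w (Z' u))
        ≤ ∑ Z' ∈ pinned p₀ (S.erase r), ∑ g ∈ T, (∏ r'' ∈ R', ind (g r'' ∈ cubes (Z' r''))) *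
            (∏ u ∈ S.erase r \ R', ind (inc (Z' u) (Z' (τ' u)))) * ∏ u ∈ S.erase r, w (Z' u) :=
          sum_le_sum fun Z' _ => hstep Z'
      _ = ∑ g ∈ T, W p₀ cubes inc w (S.erase r) R' τ' g := by rw [sum_comm]; rfl
      _ ≤ ∑ g ∈ T, M := sum_le_sum fun g _ => hM g
      _ = ((reach p).card : ℝ) ^ C.card * M := by
          rw [sum_const, nsmul_eq_mul, hTdef, card_choices reach C a p]
          push_cast
          ring
  -- the outer sum over the root polymer
  have hCcard : (C.card.factorial : ℝ) * ∏ u ∈ S.erase r, ((children (S.erase r) R' u τ').card.factorial : ℝ) =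
      ∏ u ∈ S, ((children S R u τ).card.factorial : ℝ) := by
    rw [← mul_prod_erase S _ hrS]
    congr 1
    exact prod_congr rfl fun u hu => by rw [hR'def, hτ'def, hCdef, children_cut_eq hr τ (mem_erase.1 hu).1]
  have hcards : C.card + R.card ≤ S.card := by
    rw [← card_union_of_disjoint (disjoint_left.2 fun u huC huR => (mem_sdiff.1 (hCsub huC)).2 huR)]
    exact card_le_card (union_subset (hCsub.trans sdiff_subset) hRS)
  have hR'card : R'.card = R.card - 1 + C.card := by
    rw [hR'def, card_union_of_disjoint (disjoint_left.2 fun u hu huC =>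
      (mem_sdiff.1 (hCsub huC)).2 (mem_erase.1 hu).2), card_erase_of_mem hr]
  have hexp : C.card + ((S.erase r).card - R'.card) = S.card - R.card := by
    rw [card_erase_of_mem hrS, hR'card]
    have h1 : 1 ≤ R.card := card_pos.2 ⟨r, hr⟩
    have h2 : 1 ≤ S.card := card_pos.2 ⟨r, hrS⟩
    omega
  calc W p₀ cubes inc w S R τ a
      = ∑ p : P, ∑ Z' ∈ pinned p₀ (S.erase r), ind (a r ∈ cubes p) * w p * (∏ u ∈ C, ind (inc (Z' u) p)) *
          ((∏ r' ∈ R.erase r, ind (a r' ∈ cubes (Z' r'))) *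
            (∏ u ∈ (S \ R) \ C, ind (inc (Z' u) (Z' (τ u)))) * ∏ u ∈ S.erase r, w (Z' u)) := by
        unfold W
        rw [sum_pinned_erase p₀ hrS]
        exact sum_congr rfl fun p _ => sum_congr rfl fun Z' _ => hsplit p Z'
    _ = ∑ p : P, ind (a r ∈ cubes p) * w p * ∑ Z' ∈ pinned p₀ (S.erase r), (∏ u ∈ C, ind (inc (Z' u) p)) *
          ((∏ r' ∈ R.erase r, ind (a r' ∈ cubes (Z' r'))) *
            (∏ u ∈ (S \ R) \ C, ind (inc (Z' u) (Z' (τ u)))) * ∏ u ∈ S.erase r, w (Z' u)) := by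
        refine sum_congr rfl fun p _ => ?_
        rw [mul_sum]
        exact sum_congr rfl fun Z' _ => by ring
    _ ≤ ∑ p : P, ind (a r ∈ cubes p) * w p * (((reach p).card : ℝ) ^ C.card * M) :=
        sum_le_sum fun p _ => mul_le_mul_of_nonneg_left (hinner p) (mul_nonneg (ind_nonneg _) (hw p))
    _ ≤ ∑ p : P, ind (a r ∈ cubes p) * w p * ((ν * (cubes p).card) ^ C.card * M) :=
        sum_le_sum fun p _ => mul_le_mul_of_nonneg_left
          (mul_le_mul_of_nonneg_right (pow_le_pow_left₀ (Nat.cast_nonneg _) (hreach p) _) hM0)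
          (mul_nonneg (ind_nonneg _) (hw p))
    _ = ν ^ C.card * M * ∑ p : P, ind (a r ∈ cubes p) * w p * ((cubes p).card : ℝ) ^ C.card := by
        rw [mul_sum]
        exact sum_congr rfl fun p _ => by rw [mul_pow]; ring
    _ ≤ ν ^ C.card * M * ((C.card.factorial : ℝ) * Φ) :=
        mul_le_mul_of_nonneg_left (sum_anchor_pow_le cubes w hw hΦ (a r) C.card) (mul_nonneg (pow_nonneg hν _) hM0)
    _ = Φ ^ S.card * ν ^ (S.card - R.card) * ∏ u ∈ S, ((children S R u τ).card.factorial : ℝ) := by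
        have hΦpow : Φ ^ S.card = Φ * Φ ^ (S.erase r).card := by
          rw [card_erase_of_mem hrS, ← pow_succ', Nat.sub_add_cancel (card_pos.2 ⟨r, hrS⟩)]
        rw [← hCcard, ← hexp, pow_add, hΦpow, hMdef]
        ring

end Bound

end Summit.QuantumFields.BalabanUV.T4Continuum.UrsellTreeSum

end
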